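import Summits.PneNP.PneNP.Theorems.ExpanderLinearGeneratorsResKRung
import HarnessLib

/-!
# The `Res(k)` rung for expanding linear systems, XII: CNFs implied row-wise, expanding CNFs

Support file for `stmt-PneNP-11443`. The `Res(k)` rung (file XI) only uses two properties of the
refuted CNF `sumEncoding 1 E`: every clause lives on the variables of ONE row of `E` and is implied
by that row's equation. This file records the rung for every CNF with that property
(`RowImplied E φ`, `resK_lowerBound_rowImplied`), and derives the UNCONDITIONAL `Res(k)` lower
bound for every CNF whose clause-variable sets form a boundary expander
(`expandingCNF_resK_lowerBound`): a clause `C` is implied by the parity equation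
`Σ_{x ∈ vars C} x = 1 + #(negative literals of C)` of the session-9 calibration
(`LinGen.clause_eval_of_holds`), and the system of these equations has the variable sets of the
clauses as row supports. No unsatisfiability, sparsity or column-weight hypothesis is needed.

In particular (file XIII) random `ℓ`-CNFs of linear size are such CNFs with high probability, which
gives the tree an unconditional form of the Segerlind–Buss–Impagliazzo / Alekhnovich theorem
"random `O(1)`-CNFs require exponential `Res(k)` refutations".

[Alekhnovich 2011, Thm. 1.1–1.2; Segerlind–Buss–Impagliazzo 2004, §6; Krajíček 2019, §13.4]
-/

namespace Summit.PneNP.PneNP.Theorems.ResKRestriction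

open Finset Filter Literature.Computability.Complexity Literature.Computability.MetaComplexity

variable {m n : ℕ}

/-! ### Row-implied CNFs -/

/-- `RowImplied E φ`: every clause of `φ` lives on the variables of some row of `E` and is implied
by the equation of that row. [Ben-Sasson–Wigderson 2001, §4.2 (axioms of Tseitin-type CNFs)]
[folklore] -/
def RowImplied (E : Fin m → LinEqMod 2 n) (φ : CNF ℕ) : Prop :=
  ∀ C ∈ clauseSet φ, ∃ k : Fin m, (∀ l ∈ C, l.1 ∈ rowVars E k) ∧
    ∀ σ : ℕ → Bool, (E k).Holds (blockVals 2 1 n σ) → finsetClauseEval σ C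

/-- The XOR-CNF of a system is row-implied by it. [folklore] -/
theorem rowImplied_sumEncoding (E : Fin m → LinEqMod 2 n) : RowImplied E (sumEncoding 1 E) :=
  fun _ hC => exists_row_of_mem_clauseSet E hC

/-- **Restricted clauses of a row-implied CNF are implied by their (non-closure) row, relative to
`ρ`** (file V's `exists_row_rel_of_mem_restrictFormula` for general `φ`). [folklore] -/
theorem exists_row_rel_of_mem_restrictFormula' {E : Fin m → LinEqMod 2 n} {φ : CNF ℕ}
    (hφ : RowImplied E φ) {Icl : Finset (Fin m)} {A : Finset ℕ} {ρ : ℕ → Option Bool}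
    (hρA : ∀ v, ρ v = none ↔ v ∉ A) (hcl : ∀ i ∈ Icl, rowVars E i ⊆ A)
    (hsat : ∀ i ∈ Icl, (E i).Holds (blockVals 2 1 n fun v => (ρ v).getD false))
    {C : Finset (Literal ℕ)} (hC : C ∈ restrictFormula ρ (clauseSet φ)) :
    ∃ k, k ∉ Icl ∧ RowsImplyRel E ρ {k} C := by
  obtain ⟨C₀, hC₀, hns, rfl⟩ := hC
  obtain ⟨k, hvars, himp⟩ := hφ C₀ hC₀
  have key : ∀ σ : ℕ → Bool, Agrees σ ρ → ∀ l ∈ C₀, l.eval σ = true → ρ l.1 = none := by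
    intro σ hσρ l hl e
    cases hρl : ρ l.1 with
    | none => rfl
    | some b =>
      exfalso
      have hσl : σ l.1 = b := hσρ _ _ hρl
      have hb : b = l.2 := by
        simp [Literal.eval] at e; rw [← hσl, e]
      exact hns ⟨l, hl, by rw [hρl, hb]⟩
  refine ⟨k, fun hk => ?_, fun σ hσρ hσ => ?_⟩
  · obtain ⟨l, hl, e⟩ := himp _ (hsat k hk)
    have h1 := key _ (agrees_getD ρ) l hl e
    exact (hρA l.1).1 h1 (hcl k hk (hvars l hl))
  · obtain ⟨l, hl, e⟩ := himp σ (hσ k (Finset.mem_singleton_self k))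
    exact ⟨l, mem_restrictClause.2 ⟨hl, key σ hσρ l hl e⟩, e⟩

/-- **No refutation of a row-implied CNF has shallow strong trees everywhere (good sample
points)** (file VII's `exists_line_not_ev` for general `φ`). [folklore] -/
theorem exists_line_not_ev' {E : Fin m → LinEqMod 2 n} {r c : ℝ} {V M : ℕ}
    (hexp : IsBoundaryExpander (rowVars E) r c) (hc : 0 < c) {φ : CNF ℕ} (hφ : RowImplied E φ)
    {u : Fin V → Fin M} (hu : Good (n := n) r c V M u) (hr : 4 ≤ r)
    {k H : ℕ} (hH : (3 * H : ℝ) < c * r / 8) {π : List (ResKLine ℕ)}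
    (hπ : IsResKRefutation k φ π) (y : Fin V → Bool) :
    ∃ L ∈ π, ¬ Ev L.dnf (rho E r c V M u y) H := by
  by_contra hall
  push Not at hall
  have hder := resDerivable_empty_of_forall_ev hπ (rho E r c V M u y) hall
  refine not_resDerivable_empty_rel (E := E) (Icl := Icl E r c V M u) (A := Aset E r c V M u)
    (ρ := rho E r c V M u y) (r' := r / 2) (c' := c / 2) (relExpander_closure E r c _)
    (by linarith) (by linarith) (fun v hv => (rho_eq_none_iff u y v).2 hv)
    (fun _ hC => exists_row_rel_of_mem_restrictFormula' hφ (fun v => rho_eq_none_iff u y v)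
      (fun i hi => rowVars_subset_assigned hi) (holds_rho_getD hexp hc hu y) hC) ?_ hder
  push_cast
  linarith

/-- **The `Res(k)` rung for row-implied CNFs.** As `resK_lowerBound_expander` (file XI), for every
CNF `φ` row-implied by the expanding system `E` in place of `sumEncoding 1 E`.
[Alekhnovich 2011, §4; Segerlind–Buss–Impagliazzo 2004, §3, §5] [folklore] -/
theorem resK_lowerBound_rowImplied (ℓ k : ℕ) (δ : ℝ) (hk : 1 ≤ k) (hkl : 8 * k ≤ 3 * ℓ) (hδ : 0 < δ)
    (hδk : δ * ((k : ℝ) ^ 2 + k + 2) < 2) :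
    ∃ ε : ℝ, 0 < ε ∧ ∃ N : ℕ, ∀ n : ℕ, N ≤ n → ∀ (m : ℕ) (E : Fin m → LinEqMod 2 n),
      IsBoundaryExpander (fun i => (E i).supp.map Fin.valEmbedding) ((n : ℝ) ^ (1 - δ)) (3 / 4 * ℓ) →
      ∀ φ : CNF ℕ, RowImplied E φ →
      ∀ π : List (ResKLine ℕ), IsResKRefutation k φ π →
        (2 : ℝ) ^ ((n : ℝ) ^ ε) ≤ (resKSize π : ℝ) := by
  -- constants
  set c : ℝ := 3 / 4 * ℓ with hcdef
  have hℓ : (3 : ℝ) ≤ ℓ := by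
    have : 3 ≤ ℓ := by omega
    exact_mod_cast this
  have hc : 0 < c := by rw [hcdef]; linarith
  have hkc : 2 * (k : ℝ) ≤ c := by
    have : ((8 * k : ℕ) : ℝ) ≤ ((3 * ℓ : ℕ) : ℝ) := by exact_mod_cast hkl
    push_cast at this; rw [hcdef]; linarith
  have htri : ((tri k : ℕ) : ℝ) = ((k : ℝ) ^ 2 + k) / 2 := cast_tri k
  have hγ : 0 < 1 - δ * (1 + tri k) := by rw [htri]; nlinarith
  have hδ1 : δ < 1 := by
    have : (0 : ℝ) ≤ tri k := Nat.cast_nonneg _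
    nlinarith
  set γ := 1 - δ * (1 + tri k) with hγdef
  refine ⟨γ / 2, by positivity, ?_⟩
  obtain ⟨N, hN⟩ := Filter.eventually_atTop.1 (eventually_params hc hδ k hγ)
  refine ⟨N, fun n hn m E hexp φ hφ π hπ => ?_⟩
  obtain ⟨hr4, hr6, hc32, hε2, hmain⟩ := hN n hn
  set r : ℝ := (n : ℝ) ^ (1 - δ) with hrdef
  have hexp' : IsBoundaryExpander (rowVars E) r c := hexp
  have hr0 : 0 < r := by linarith
  have hn0 : (0 : ℝ) ≤ n := Nat.cast_nonneg n
  have hnpos : 0 < n := by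
    rcases Nat.eq_zero_or_pos n with h | h
    · exfalso; subst h
      have h1 : (1 : ℝ) - δ ≠ 0 := by linarith
      have : r = 0 := by rw [hrdef, Nat.cast_zero, Real.zero_rpow h1]
      linarith
    · exact h
  have hnreal : (n : ℝ) = (n : ℝ) ^ δ * r := by
    have h1 : (0 : ℝ) ≤ 1 - δ := by linarith
    rw [hrdef, ← Real.rpow_add_of_nonneg hn0 hδ.le h1]
    norm_num
  have hnδ : 0 < (n : ℝ) ^ δ := Real.rpow_pos_of_pos (by exact_mod_cast hnpos) _
  have hcr32 : c * r ≤ 32 * n := by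
    rw [hnreal]; nlinarith
  -- suppose the refutation is short
  by_contra hlt
  push Not at hlt
  rw [resKSize_eq_length] at hlt
  obtain ⟨hM1, hnM, hM64⟩ := ceil_params hc hr0 hnpos hcr32
  set M := ⌈32 * (n : ℝ) / (c * r)⌉₊ with hMdef
  set T := ⌊(n : ℝ) ^ (γ / 2)⌋₊ + 2 with hTdef
  have hT1 : 1 ≤ T := by omega
  set V := max n (varBound π) with hVdef
  have hnV : n ≤ V := le_max_left _ _
  have hπV : ∀ L ∈ π, ∀ t ∈ L.dnf, ∀ l ∈ t, l.1 < V := fun L hL t ht l hl =>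
    lt_of_lt_of_le (lt_varBound hL ht hl) (le_max_right _ _)
  have hπk : ∀ L ∈ π, IsKDNF k L.dnf := by
    intro L hL
    obtain ⟨i, hi, rfl⟩ := List.getElem_of_mem hL
    exact (hπ.1 i hi).1
  have hM64' : (M : ℝ) ≤ 64 / c * (n : ℝ) ^ δ := by
    calc (M : ℝ) ≤ 64 * n / (c * r) := hM64
      _ = 64 * ((n : ℝ) ^ δ * r) / (c * r) := by rw [← hnreal]
      _ = 64 / c * (n : ℝ) ^ δ := by field_simp
  have hTle : (T : ℝ) ≤ (n : ℝ) ^ (γ / 2) + 2 := by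
    rw [hTdef]; push_cast
    linarith [Nat.floor_le (Real.rpow_nonneg hn0 (γ / 2))]
  have hH : (3 * (hgt M k T) : ℝ) < c * r / 8 := by
    have h1 := hgt_le hM1 k T hT1
    have h2 : (M : ℝ) ^ tri k ≤ (64 / c * (n : ℝ) ^ δ) ^ tri k :=
      pow_le_pow_left₀ (by positivity) hM64' _
    have hB : (0 : ℝ) ≤ Bconst k := Nat.cast_nonneg _
    calc (3 * (hgt M k T) : ℝ) ≤ 3 * ((Bconst k : ℝ) * (M : ℝ) ^ tri k * T) := by linarith
      _ ≤ 3 * ((Bconst k : ℝ) * (64 / c * (n : ℝ) ^ δ) ^ tri k * ((n : ℝ) ^ (γ / 2) + 2)) := by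
          gcongr
      _ = 3 * (Bconst k : ℝ) * (64 / c * (n : ℝ) ^ δ) ^ tri k * ((n : ℝ) ^ (γ / 2) + 2) := by ring
      _ < c * r / 8 := hmain
  have hS : (π.length : ℝ) * ((2 : ℝ) ^ T)⁻¹ < 1 / 2 := size_mul_inv_two_pow_lt_half hlt
  have hab : ((((Finset.univ : Finset (Fin V → Fin M)).filter
      fun u => ¬ Good (n := n) r c V M u).card : ℝ)) ≤ (M : ℝ) ^ V / 2 := by
    refine (card_not_good_le hnV hM1 (by positivity)).trans ?_
    have h1 : Real.exp ((n : ℝ) / M) ≤ Real.exp (c * r / 32) := Real.exp_le_exp.2 hnM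
    have h2 := exp_mul_inv_two_pow_le_half hr6
    have h3 : (0 : ℝ) ≤ ((2 : ℝ) ^ (⌊c * r / 4⌋₊ + 1))⁻¹ := by positivity
    calc (M : ℝ) ^ V * Real.exp ((n : ℝ) / M) * ((2 : ℝ) ^ (⌊c * r / 4⌋₊ + 1))⁻¹
        ≤ (M : ℝ) ^ V * (Real.exp (c * r / 32) * ((2 : ℝ) ^ (⌊c * r / 4⌋₊ + 1))⁻¹) := by
          rw [mul_assoc]; gcongr
      _ ≤ (M : ℝ) ^ V * (1 / 2) := by gcongr
      _ = (M : ℝ) ^ V / 2 := by ring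
  obtain ⟨u, y, hu, hall⟩ := exists_good_point hexp' hc hnV hM1 hkc π hπk hπV T hS hab
  obtain ⟨L, hL, hnot⟩ := exists_line_not_ev' hexp' hc hφ hu hr4 hH hπ y
  exact hnot (hall L hL)

end Summit.PneNP.PneNP.Theorems.ResKRestriction
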